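/-
BALABAN–IMBRIE–JAFFE 1988 (CMP 114), §5.13 p.306 [PDF 50], display (5.13.3): the product of the trains is taken over
the UNORDERED parts of a partition, «Σ_{π∈𝒫(Γ)} ⟨ Π_{α∈π} [ Σ_{ω(α)} ⟨δ/δΦ, C_s □_{i₁} Δ □_{i₂} C_s … C_s (½ δ/δΦ + ℱ)⟩ ]
Π_{i∈I} f(□_i) ⟩_{s_Γ}».

ORDER-INDEPENDENCE OF THE TRAIN OPERATORS (clause C4 of row C2.Eq5.13.3-5.13.4).  In the tree the product
`Π_{c∈P} 𝕋_c` of `BIJ88WalkForm5133.dexp_eq_sum_trains` is the composition `trains f C N P.toList` of the train operators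
`𝕋_c = ∂_{C𝔫(c)ℱ} + ½ Σ_{pq} (C𝔫(c))_{pq} ∂_p∂_q` (`BIJ88TrainPieces306.trainOp`) along a fixed enumeration `P.toList`;
the print's `Π_{α∈π}` is unordered.  This file proves that the composition does not depend on the enumeration: on a
linear class of smooth factors (`IsSmoothClass`: C¹-bounded members, closed under directional derivatives, hence
Schwarz `fderiv_fderiv_comm`) the train operators are constant-coefficient differential operators of order ≤ 2 and
COMMUTE — `trainOp_comm` — so `trains f C N l G = trains f C N l' G` for any two enumerations `l ~ l'` — `trains_perm`.

statement-level skeleton of published theorems with citation tags; proofs where landed; nothing here is a claim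
about the Yang–Mills mass gap

PDF held: `paper:balaban1988-cmp114-bij-abelian-higgs-effective-action` (journal page = PDF page + 256).

CITATION HEADER (lean-in-tree rule).  lit-balaban cell (HOME `run/shared/lean/pub/lit-balaban/`), Phase 2, seat p13
gen 14; row **C2.Eq5.13.3-5.13.4** of `HOME/lit-balaban-r16/ROWS-C2-part2.md` (owner r16, referee ref-5), clause C4 of
the v2.148 flip record («the operator product Π_{c∈P}𝕋_c is taken along `P.toList` … print's Π_α is unordered»).  USED
BY NAME: `BIJ88SmoothClassCalculus306.IsSmoothClass.{fderiv_fderiv_comm, fderiv_mem, differentiable}`,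
`BIJ88TrainPieces306.{trainOp, D2}`, `BIJ88WalkForm5133.{trains, trainOp_mem, trains_mem}`.

## Main statements

* `fderiv_trainOp` — a directional derivative commutes with a train operator on the class.
* `rot3` — third-order mixed directional derivatives of a member are invariant under rotation of the directions.
* `trainOp_comm` — **two train operators commute on the class.**
* `trains_perm` — **the product of the train operators of a list of groups depends only on the list up to permutation.**

## References

* [BalabanImbrieJaffe1988] T. Bałaban, J. Imbrie, A. Jaffe, *Effective action and cluster properties of the abelian
  Higgs model*, Comm. Math. Phys. 114 (1988) 257–315, §5.13 p.306.
-/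
import Literature.MathematicalPhysics.QuantumFieldTheory.BalabanImbrieJaffe1984to88.BIJ88WalkForm5133

noncomputable section

namespace Literature.MathematicalPhysics.QuantumFieldTheory.BalabanImbrieJaffe1984to88.BIJ88TrainsCommute5133

open Finset Matrix Function
open scoped BigOperators
open Literature.MathematicalPhysics.QuantumFieldTheory.Balaban1983to89
open BIJ88SmoothClassCalculus306 (IsSmoothClass)
open BIJ88TrainPieces306 (trainOp D2 wker)
open BIJ88WalkForm5133 (trains trains_cons trainOp_mem trains_mem)

variable {α I : Type} [Fintype α] [DecidableEq α] [Fintype I] [DecidableEq I]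
  {𝒞 : Submodule ℝ ((α → ℝ) → ℝ)} (h𝒞 : IsSmoothClass 𝒞) (f : α → ℝ)

/-! ## §1  Directional derivatives commute with the train operators -/

omit [Fintype I] [DecidableEq I] in
/-- the train operator, unfolded at a point. [cite: BalabanImbrieJaffe1988, §5.13 p.306] -/
theorem trainOp_apply (K : Matrix α α ℝ) (G : (α → ℝ) → ℝ) (φ : α → ℝ) :
    trainOp f K G φ = fderiv ℝ G φ (K *ᵥ f)
      + (1/2 : ℝ) * ∑ p, ∑ q, K p q * fderiv ℝ (fun ψ => fderiv ℝ G ψ (Pi.single q 1)) φ (Pi.single p 1) := rfl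

include h𝒞 in
omit [DecidableEq α] [Fintype I] [DecidableEq I] in
/-- Schwarz, as an identity of functions: `∂_v ∂_w G = ∂_w ∂_v G` on the class. [cite: BalabanImbrieJaffe1988, §5.13 p.306] -/
theorem fderiv_fderiv_comm_fun {G : (α → ℝ) → ℝ} (hG : G ∈ 𝒞) (v w : α → ℝ) :
    (fun φ => fderiv ℝ (fun ψ => fderiv ℝ G ψ w) φ v) = fun φ => fderiv ℝ (fun ψ => fderiv ℝ G ψ v) φ w :=
  funext fun φ => h𝒞.fderiv_fderiv_comm hG v w φ

include h𝒞 in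
omit [DecidableEq α] [Fintype I] [DecidableEq I] in
/-- **rotation of three directions**: `∂_u ∂_v ∂_w G = ∂_w ∂_u ∂_v G` on the class (the innermost direction moved
outermost). [cite: BalabanImbrieJaffe1988, §5.13 p.306] -/
theorem rot3 {G : (α → ℝ) → ℝ} (hG : G ∈ 𝒞) (u v w φ : α → ℝ) :
    fderiv ℝ (fun ψ => fderiv ℝ (fun χ => fderiv ℝ G χ w) ψ v) φ u
      = fderiv ℝ (fun ψ => fderiv ℝ (fun χ => fderiv ℝ G χ v) ψ u) φ w := by
  -- `∂_v ∂_w G = ∂_w ∂_v G` as functions, then Schwarz for the member `∂_v G`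
  rw [fderiv_fderiv_comm_fun h𝒞 hG v w]
  exact h𝒞.fderiv_fderiv_comm (h𝒞.fderiv_mem G hG v) u w φ

include h𝒞 in
omit [Fintype I] [DecidableEq I] in
/-- **a directional derivative commutes with a train operator** on the class:
`∂_w (𝕋_K G) = 𝕋_K (∂_w G)`. [cite: BalabanImbrieJaffe1988, §5.13 p.306] -/
theorem fderiv_trainOp {G : (α → ℝ) → ℝ} (hG : G ∈ 𝒞) (K : Matrix α α ℝ) (w φ : α → ℝ) :
    fderiv ℝ (trainOp f K G) φ w = trainOp f K (fun ψ => fderiv ℝ G ψ w) φ := by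
  -- differentiability of the pieces
  have hA : DifferentiableAt ℝ (fun ψ => fderiv ℝ G ψ (K *ᵥ f)) φ :=
    h𝒞.differentiable (h𝒞.fderiv_mem G hG _) φ
  have hB : ∀ p q : α, DifferentiableAt ℝ
      (fun ψ => fderiv ℝ (fun χ => fderiv ℝ G χ (Pi.single q 1)) ψ (Pi.single p 1)) φ := fun p q =>
    h𝒞.differentiable (h𝒞.fderiv_mem _ (h𝒞.fderiv_mem G hG _) _) φ
  have hsum : HasFDerivAt
      (fun ψ => ∑ p, ∑ q, K p q * fderiv ℝ (fun χ => fderiv ℝ G χ (Pi.single q 1)) ψ (Pi.single p 1))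
      (∑ p, ∑ q, K p q • fderiv ℝ
        (fun ψ => fderiv ℝ (fun χ => fderiv ℝ G χ (Pi.single q 1)) ψ (Pi.single p 1)) φ) φ :=
    HasFDerivAt.fun_sum fun p _ => HasFDerivAt.fun_sum fun q _ => ((hB p q).hasFDerivAt).const_mul (K p q)
  have hT : HasFDerivAt (trainOp f K G)
      (fderiv ℝ (fun ψ => fderiv ℝ G ψ (K *ᵥ f)) φ + (1/2 : ℝ) • ∑ p, ∑ q, K p q • fderiv ℝ
        (fun ψ => fderiv ℝ (fun χ => fderiv ℝ G χ (Pi.single q 1)) ψ (Pi.single p 1)) φ) φ := by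
    have h := hA.hasFDerivAt.add (hsum.const_mul (1/2 : ℝ))
    exact h
  rw [hT.fderiv, trainOp_apply]
  simp only [_root_.add_apply, FunLike.coe_smul, Pi.smul_apply, FunLike.coe_sum, Finset.sum_apply, smul_eq_mul]
  congr 1
  · exact h𝒞.fderiv_fderiv_comm hG w (K *ᵥ f) φ
  · congr 1
    refine sum_congr rfl fun p _ => sum_congr rfl fun q _ => ?_
    congr 1
    -- `∂_w ∂_p ∂_q G = ∂_p ∂_q ∂_w G`
    rw [h𝒞.fderiv_fderiv_comm (h𝒞.fderiv_mem G hG _) w (Pi.single p 1) φ,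
      fderiv_fderiv_comm_fun h𝒞 hG w (Pi.single q 1)]

/-! ## §2  Train operators commute -/

include h𝒞 in
omit [Fintype I] [DecidableEq I] in
/-- **TWO TRAIN OPERATORS COMMUTE ON THE CLASS**: `𝕋_K (𝕋_{K'} G) = 𝕋_{K'} (𝕋_K G)` for `G ∈ 𝒞` (constant-coefficient
operators of order ≤ 2; Schwarz up to order four). [cite: BalabanImbrieJaffe1988, §5.13 Eq. (5.13.3) p.306] -/
theorem trainOp_comm {G : (α → ℝ) → ℝ} (hG : G ∈ 𝒞) (K K' : Matrix α α ℝ) :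
    trainOp f K (trainOp f K' G) = trainOp f K' (trainOp f K G) := by
  funext φ
  -- move the outer operator inside, on both sides
  have hL : ∀ (K K' : Matrix α α ℝ), trainOp f K (trainOp f K' G) φ
      = trainOp f K' (fun ψ => fderiv ℝ G ψ (K *ᵥ f)) φ
        + (1/2 : ℝ) * ∑ p, ∑ q, K p q *
          trainOp f K' (fun ψ => fderiv ℝ (fun χ => fderiv ℝ G χ (Pi.single q 1)) ψ (Pi.single p 1)) φ := by
    intro K K'
    rw [trainOp_apply f K (trainOp f K' G)]
    congr 1
    · exact fderiv_trainOp h𝒞 f hG K' _ φ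
    · congr 1
      refine sum_congr rfl fun p _ => sum_congr rfl fun q _ => ?_
      congr 1
      have e : (fun ψ => fderiv ℝ (trainOp f K' G) ψ (Pi.single q 1))
          = trainOp f K' (fun ψ => fderiv ℝ G ψ (Pi.single q 1)) :=
        funext fun ψ => fderiv_trainOp h𝒞 f hG K' _ ψ
      rw [e]
      exact fderiv_trainOp h𝒞 f (h𝒞.fderiv_mem G hG _) K' _ φ
  rw [hL K K', hL K' K]
  -- expand the remaining (inner) operators and compare term by term
  simp only [trainOp_apply]
  -- second order: Schwarz
  have h1 : fderiv ℝ (fun ψ => fderiv ℝ G ψ (K *ᵥ f)) φ (K' *ᵥ f)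
      = fderiv ℝ (fun ψ => fderiv ℝ G ψ (K' *ᵥ f)) φ (K *ᵥ f) :=
    h𝒞.fderiv_fderiv_comm hG (K' *ᵥ f) (K *ᵥ f) φ
  -- third order: `Σ_rs M_rs ∂_r∂_s(∂_a G) = Σ_rs M_rs ∂_a(∂_r∂_s G)`
  have e3 : ∀ (M : Matrix α α ℝ) (a : α → ℝ),
      (∑ r, ∑ s, M r s * fderiv ℝ (fun ψ => fderiv ℝ (fun χ => fderiv ℝ G χ a) ψ (Pi.single s 1)) φ (Pi.single r 1))
        = ∑ r, ∑ s, M r s *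
            fderiv ℝ (fun ψ => fderiv ℝ (fun χ => fderiv ℝ G χ (Pi.single s 1)) ψ (Pi.single r 1)) φ a :=
    fun M a => sum_congr rfl fun r _ => sum_congr rfl fun s _ => by
      rw [rot3 h𝒞 hG (Pi.single r 1) (Pi.single s 1) a φ]
  -- fourth order: `∂_r∂_s(∂_p∂_q G) = ∂_p∂_q(∂_r∂_s G)`
  have h4 : ∀ p q r s : α,
      fderiv ℝ (fun ψ => fderiv ℝ
          (fun ψ₀ => fderiv ℝ (fun χ => fderiv ℝ G χ (Pi.single q 1)) ψ₀ (Pi.single p 1)) ψ (Pi.single s 1))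
          φ (Pi.single r 1)
        = fderiv ℝ (fun ψ => fderiv ℝ
          (fun ψ₀ => fderiv ℝ (fun χ => fderiv ℝ G χ (Pi.single s 1)) ψ₀ (Pi.single r 1)) ψ (Pi.single q 1))
          φ (Pi.single p 1) := by
    intro p q r s
    rw [rot3 h𝒞 (h𝒞.fderiv_mem G hG (Pi.single q 1)) (Pi.single r 1) (Pi.single s 1) (Pi.single p 1) φ]
    have hF : (fun ψ => fderiv ℝ (fun χ => fderiv ℝ (fun χ' => fderiv ℝ G χ' (Pi.single q 1)) χ (Pi.single s 1))
        ψ (Pi.single r 1))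
        = fun ψ => fderiv ℝ (fun ψ₀ => fderiv ℝ (fun χ => fderiv ℝ G χ (Pi.single s 1)) ψ₀ (Pi.single r 1))
          ψ (Pi.single q 1) :=
      funext fun ψ => rot3 h𝒞 hG (Pi.single r 1) (Pi.single s 1) (Pi.single q 1) ψ
    rw [hF]
  -- the quartic sums agree after swapping the order of summation
  have hswap : (∑ p, ∑ q, K p q * ((1/2 : ℝ) * ∑ r, ∑ s, K' r s *
      fderiv ℝ (fun ψ => fderiv ℝ
        (fun ψ₀ => fderiv ℝ (fun χ => fderiv ℝ G χ (Pi.single q 1)) ψ₀ (Pi.single p 1)) ψ (Pi.single s 1))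
        φ (Pi.single r 1)))
      = ∑ p, ∑ q, K' p q * ((1/2 : ℝ) * ∑ r, ∑ s, K r s *
      fderiv ℝ (fun ψ => fderiv ℝ
        (fun ψ₀ => fderiv ℝ (fun χ => fderiv ℝ G χ (Pi.single q 1)) ψ₀ (Pi.single p 1)) ψ (Pi.single s 1))
        φ (Pi.single r 1)) := by
    have lhs : (∑ p, ∑ q, K p q * ((1/2 : ℝ) * ∑ r, ∑ s, K' r s *
        fderiv ℝ (fun ψ => fderiv ℝ
          (fun ψ₀ => fderiv ℝ (fun χ => fderiv ℝ G χ (Pi.single q 1)) ψ₀ (Pi.single p 1)) ψ (Pi.single s 1))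
          φ (Pi.single r 1)))
        = ∑ p, ∑ q, ∑ r, ∑ s, (1/2 : ℝ) * (K p q * K' r s) *
          fderiv ℝ (fun ψ => fderiv ℝ
            (fun ψ₀ => fderiv ℝ (fun χ => fderiv ℝ G χ (Pi.single s 1)) ψ₀ (Pi.single r 1)) ψ (Pi.single q 1))
            φ (Pi.single p 1) := by
      refine sum_congr rfl fun p _ => sum_congr rfl fun q _ => ?_
      rw [Finset.mul_sum, Finset.mul_sum]
      refine sum_congr rfl fun r _ => ?_
      rw [Finset.mul_sum, Finset.mul_sum]
      refine sum_congr rfl fun s _ => ?_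
      rw [h4 p q r s]
      ring
    have rhs : (∑ p, ∑ q, K' p q * ((1/2 : ℝ) * ∑ r, ∑ s, K r s *
        fderiv ℝ (fun ψ => fderiv ℝ
          (fun ψ₀ => fderiv ℝ (fun χ => fderiv ℝ G χ (Pi.single q 1)) ψ₀ (Pi.single p 1)) ψ (Pi.single s 1))
          φ (Pi.single r 1)))
        = ∑ p, ∑ q, ∑ r, ∑ s, (1/2 : ℝ) * (K r s * K' p q) *
          fderiv ℝ (fun ψ => fderiv ℝ
            (fun ψ₀ => fderiv ℝ (fun χ => fderiv ℝ G χ (Pi.single q 1)) ψ₀ (Pi.single p 1)) ψ (Pi.single s 1))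
            φ (Pi.single r 1) := by
      refine sum_congr rfl fun p _ => sum_congr rfl fun q _ => ?_
      rw [Finset.mul_sum, Finset.mul_sum]
      refine sum_congr rfl fun r _ => ?_
      rw [Finset.mul_sum, Finset.mul_sum]
      exact sum_congr rfl fun s _ => by ring
    rw [lhs, rhs]
    -- `Σ_p Σ_q Σ_r Σ_s F p q r s = Σ_r Σ_s Σ_p Σ_q F p q r s`
    calc (∑ p, ∑ q, ∑ r, ∑ s, (1/2 : ℝ) * (K p q * K' r s) *
          fderiv ℝ (fun ψ => fderiv ℝ
            (fun ψ₀ => fderiv ℝ (fun χ => fderiv ℝ G χ (Pi.single s 1)) ψ₀ (Pi.single r 1)) ψ (Pi.single q 1))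
            φ (Pi.single p 1))
        = ∑ p, ∑ r, ∑ q, ∑ s, (1/2 : ℝ) * (K p q * K' r s) *
          fderiv ℝ (fun ψ => fderiv ℝ
            (fun ψ₀ => fderiv ℝ (fun χ => fderiv ℝ G χ (Pi.single s 1)) ψ₀ (Pi.single r 1)) ψ (Pi.single q 1))
            φ (Pi.single p 1) := sum_congr rfl fun p _ => Finset.sum_comm
      _ = ∑ r, ∑ p, ∑ q, ∑ s, (1/2 : ℝ) * (K p q * K' r s) *
          fderiv ℝ (fun ψ => fderiv ℝ
            (fun ψ₀ => fderiv ℝ (fun χ => fderiv ℝ G χ (Pi.single s 1)) ψ₀ (Pi.single r 1)) ψ (Pi.single q 1))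
            φ (Pi.single p 1) := Finset.sum_comm
      _ = ∑ r, ∑ p, ∑ s, ∑ q, (1/2 : ℝ) * (K p q * K' r s) *
          fderiv ℝ (fun ψ => fderiv ℝ
            (fun ψ₀ => fderiv ℝ (fun χ => fderiv ℝ G χ (Pi.single s 1)) ψ₀ (Pi.single r 1)) ψ (Pi.single q 1))
            φ (Pi.single p 1) := sum_congr rfl fun r _ => sum_congr rfl fun p _ => Finset.sum_comm
      _ = ∑ r, ∑ s, ∑ p, ∑ q, (1/2 : ℝ) * (K p q * K' r s) *
          fderiv ℝ (fun ψ => fderiv ℝ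
            (fun ψ₀ => fderiv ℝ (fun χ => fderiv ℝ G χ (Pi.single s 1)) ψ₀ (Pi.single r 1)) ψ (Pi.single q 1))
            φ (Pi.single p 1) := sum_congr rfl fun r _ => Finset.sum_comm
      _ = _ := sum_congr rfl fun r _ => sum_congr rfl fun s _ => sum_congr rfl fun p _ =>
            sum_congr rfl fun q _ => by ring
  rw [h1, e3 K' (K *ᵥ f), e3 K (K' *ᵥ f)]
  simp only [mul_add, Finset.sum_add_distrib]
  rw [hswap]
  ring

/-! ## §3  The product of the train operators does not depend on the enumeration -/

include h𝒞 in
omit [Fintype I] in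
/-- **ORDER-INDEPENDENCE OF `Π_{c∈P} 𝕋_c`** (clause C4): for `G ∈ 𝒞` and two enumerations `l ~ l'` of the groups,
`trains f C N l G = trains f C N l' G` — the print's unordered `Π_{α∈π}`. [cite: BalabanImbrieJaffe1988, §5.13 Eq. (5.13.3) p.306] -/
theorem trains_perm (C : Matrix α α ℝ) (N : Finset I → Matrix α α ℝ) {l l' : List (Finset (Finset I))}
    (h : l.Perm l') {G : (α → ℝ) → ℝ} (hG : G ∈ 𝒞) : trains f C N l G = trains f C N l' G := by
  induction h with
  | nil => rfl
  | cons c _ ih => rw [trains_cons, trains_cons, ih]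
  | swap a b l =>
      rw [trains_cons, trains_cons, trains_cons, trains_cons]
      exact trainOp_comm h𝒞 f (trains_mem f C N h𝒞 l hG) _ _
  | trans _ _ ih₁ ih₂ => exact ih₁.trans ih₂

end Literature.MathematicalPhysics.QuantumFieldTheory.BalabanImbrieJaffe1984to88.BIJ88TrainsCommute5133

end
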